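import Summits.Ventures.DiscreteObjects.Hadamard.ElemAbelian23Stab
import Summits.Ventures.DiscreteObjects.Hadamard.SignedAutCommute

/-!
# Hadamard 668 census, family F12 — `C₂₃ × C₂₃`: tools (orthogonality bound for rows agreeing on many columns,
# transitivity of a fixed-point-free 23-cycle, fixed points in an invariant set mod 23, order-23 census) (kernel)

Framing: lottery ticket; floor = certified bounds/negative ranges.

Cell pub-namedobj (venture DiscreteObjects), target (H), hadamard gen 16.  Lemmas for `ElemAbelianRank2_23`:
* `card_mul_card_le_of_const_cols`: if every column of `T` is constant along the rows `B` of a Hadamard matrix of order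
  `n`, then `|B|·|T| ≤ n` (`‖Σ_{x∈B} row_x‖² = |B|·n ≥ |T|·|B|²`);
* `exists_pow_apply_eq_23`: a permutation with `σ²³ = 1` acting without fixed points on an invariant 23-set is transitive
  there; `apply_pow_eq_of_step`: a `σ`-invariant function is constant along powers;
* `card_filter_fixed_mod_23`: for `τ²³ = 1` and a `τ`-invariant finite set `F`, `#{x ∈ F : τ x = x} ≡ |F| (mod 23)`;
* `census23`: a signed automorphism of order 23 of an H(668) has `1` or `24` fixed rows and as many fixed columns
  (`hadamard668_signedAut_fixedRows`).
Ours; no `sorry`.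
-/

namespace Summit.Ventures.DiscreteObjects.Hadamard

open Finset BigOperators

open Literature.Combinatorics.Designs.GoethalsSeidel (IsHadamardMatrix)

variable {ι : Type*} [Fintype ι] [DecidableEq ι]

/-! ## Lemmas -/

omit [Fintype ι] [DecidableEq ι] in
/-- `x^23 = x` for `x = ±1` -/
lemma pm_pow_23 {x : ℤ} (hx : x = 1 ∨ x = -1) : x ^ 23 = x := by
  rcases hx with rfl | rfl <;> norm_num

/-- **rows agreeing on many columns cannot be orthogonal**: if every column of `T` is constant along the rows of `B`
(`B ∋ x₀`) of a Hadamard matrix of order `n`, then `|B|·|T| ≤ n` (`‖Σ_{x∈B} row_x‖² = |B|·n ≥ |T|·|B|²`). -/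
lemma card_mul_card_le_of_const_cols {H : Matrix ι ι ℤ} (hH : IsHadamardMatrix H) (B T : Finset ι) (x₀ : ι)
    (hx₀ : x₀ ∈ B) (hconst : ∀ y ∈ T, ∀ x ∈ B, H x y = H x₀ y) : B.card * T.card ≤ Fintype.card ι := by
  -- ‖Σ_{x∈B} row_x‖²
  have key : ∑ y, (∑ x ∈ B, H x y) * (∑ x ∈ B, H x y) = B.card * (Fintype.card ι : ℤ) := by
    calc ∑ y, (∑ x ∈ B, H x y) * (∑ x ∈ B, H x y)
        = ∑ y, ∑ x ∈ B, ∑ x' ∈ B, H x y * H x' y := by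
          apply Finset.sum_congr rfl; intro y _; rw [Finset.sum_mul_sum]
      _ = ∑ x ∈ B, ∑ x' ∈ B, ∑ y, H x y * H x' y := by
          rw [Finset.sum_comm]; apply Finset.sum_congr rfl; intro x _; rw [Finset.sum_comm]
      _ = ∑ x ∈ B, ∑ x' ∈ B, (if x = x' then (Fintype.card ι : ℤ) else 0) := by
          apply Finset.sum_congr rfl; intro x _; apply Finset.sum_congr rfl; intro x' _
          split_ifs with h
          · subst h; exact hadamard_row_self H hH x
          · exact hadamard_row_orth H hH h
      _ = ∑ x ∈ B, (Fintype.card ι : ℤ) := by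
          apply Finset.sum_congr rfl; intro x hx; rw [Finset.sum_ite_eq B x]; simp [hx]
      _ = B.card * (Fintype.card ι : ℤ) := by rw [Finset.sum_const, nsmul_eq_mul]
  -- on T each coordinate is ± |B|
  have hT : ∑ y ∈ T, (∑ x ∈ B, H x y) * (∑ x ∈ B, H x y) = T.card * ((B.card : ℤ) * B.card) := by
    have : ∀ y ∈ T, (∑ x ∈ B, H x y) * (∑ x ∈ B, H x y) = (B.card : ℤ) * B.card := by
      intro y hy
      rw [Finset.sum_congr rfl (fun x hx => hconst y hy x hx), Finset.sum_const, nsmul_eq_mul]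
      have h1 : H x₀ y * H x₀ y = 1 := pm_mul_self (hH.1 x₀ y)
      calc (B.card : ℤ) * H x₀ y * ((B.card : ℤ) * H x₀ y) = (B.card : ℤ) * B.card * (H x₀ y * H x₀ y) := by ring
        _ = (B.card : ℤ) * B.card := by rw [h1, mul_one]
    rw [Finset.sum_congr rfl this, Finset.sum_const, nsmul_eq_mul]
  have hle : ∑ y ∈ T, (∑ x ∈ B, H x y) * (∑ x ∈ B, H x y) ≤ ∑ y, (∑ x ∈ B, H x y) * (∑ x ∈ B, H x y) :=
    Finset.sum_le_sum_of_subset_of_nonneg (Finset.subset_univ T) (fun y _ _ => mul_self_nonneg _)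
  rw [hT, key] at hle
  have hBpos : 0 < B.card := Finset.card_pos.mpr ⟨x₀, hx₀⟩
  have : (T.card : ℤ) * B.card ≤ Fintype.card ι := by
    have h2 : ((T.card : ℤ) * B.card) * B.card ≤ (Fintype.card ι : ℤ) * B.card := by
      calc ((T.card : ℤ) * B.card) * B.card = T.card * ((B.card : ℤ) * B.card) := by ring
        _ ≤ B.card * (Fintype.card ι : ℤ) := hle
        _ = (Fintype.card ι : ℤ) * B.card := by ring
    exact le_of_mul_le_mul_right h2 (by exact_mod_cast hBpos)
  have : ((B.card * T.card : ℕ) : ℤ) ≤ (Fintype.card ι : ℤ) := by push_cast; linarith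
  exact_mod_cast this

omit [Fintype ι] in
/-- **a fixed-point-free permutation of exponent 23 on an invariant 23-set is transitive there** -/
lemma exists_pow_apply_eq_23 (σ : Equiv.Perm ι) (hσ : σ ^ 23 = 1) (B : Finset ι) (hB : B.card = 23)
    (hinv : ∀ x ∈ B, σ x ∈ B) (hfpf : ∀ x ∈ B, σ x ≠ x) {x₀ : ι} (hx₀ : x₀ ∈ B) {x : ι} (hx : x ∈ B) :
    ∃ k : ℕ, (σ ^ k) x₀ = x := by
  haveI : Fact (Nat.Prime 23) := ⟨by norm_num⟩
  have hmem : ∀ k : ℕ, (σ ^ k) x₀ ∈ B := by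
    intro k; induction k with
    | zero => simpa using hx₀
    | succ k ih => rw [pow_succ', Equiv.Perm.mul_apply]; exact hinv _ ih
  set S := (Finset.range 23).image (fun k => (σ ^ k) x₀) with hS
  have hSB : S ⊆ B := by
    intro y hy; rw [hS, Finset.mem_image] at hy; obtain ⟨k, -, rfl⟩ := hy; exact hmem k
  have hScard : S.card = 23 := by
    rw [hS, Finset.card_image_of_injOn, Finset.card_range]
    intro k hk l hl hkl
    simp only [Finset.coe_range, Set.mem_Iio] at hk hl
    simp only at hkl
    by_contra hne
    rcases Nat.lt_or_gt_of_ne hne with hlt | hlt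
    · have e : (σ ^ (l - k)) ((σ ^ k) x₀) = (σ ^ k) x₀ := by
        rw [← Equiv.Perm.mul_apply, ← pow_add, show l - k + k = l by omega, ← hkl]
      exact hfpf _ (hmem k) (fixed_of_pow_fixed 23 σ hσ (by omega) (by omega) e)
    · have e : (σ ^ (k - l)) ((σ ^ l) x₀) = (σ ^ l) x₀ := by
        rw [← Equiv.Perm.mul_apply, ← pow_add, show k - l + l = k by omega, hkl]
      exact hfpf _ (hmem l) (fixed_of_pow_fixed 23 σ hσ (by omega) (by omega) e)
  have hSeq : S = B := Finset.eq_of_subset_of_card_le hSB (by rw [hB, hScard])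
  rw [← hSeq, hS, Finset.mem_image] at hx
  obtain ⟨k, -, hk⟩ := hx
  exact ⟨k, hk⟩

omit [Fintype ι] [DecidableEq ι] in
/-- a function invariant under `σ` on an invariant set is constant along powers of `σ` -/
lemma apply_pow_eq_of_step {γ : Type*} (σ : Equiv.Perm ι) (B : Finset ι) (hinv : ∀ x ∈ B, σ x ∈ B) (φ : ι → γ)
    (hstep : ∀ x ∈ B, φ (σ x) = φ x) {x₀ : ι} (hx₀ : x₀ ∈ B) (k : ℕ) : φ ((σ ^ k) x₀) = φ x₀ := by
  induction k with
  | zero => simp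
  | succ k ih =>
    have hmem : (σ ^ k) x₀ ∈ B := by
      clear ih; induction k with
      | zero => simpa using hx₀
      | succ k ih => rw [pow_succ', Equiv.Perm.mul_apply]; exact hinv _ ih
    rw [pow_succ', Equiv.Perm.mul_apply, hstep _ hmem, ih]

omit [Fintype ι] in
/-- **fixed points inside an invariant set, mod 23**: for `τ²³ = 1` and a `τ`-invariant finite set `F`,
`#{x ∈ F : τ x = x} ≡ |F| (mod 23)`. -/
lemma card_filter_fixed_mod_23 (τ : Equiv.Perm ι) (hτ : τ ^ 23 = 1) (F : Finset ι) (hF : ∀ x, x ∈ F ↔ τ x ∈ F) :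
    (F.filter fun x => τ x = x).card % 23 = F.card % 23 := by
  have hF' : ∀ x, τ x ∈ F ↔ x ∈ F := fun x => (hF x).symm
  set ρ : Equiv.Perm {x // x ∈ F} := τ.subtypePerm hF' with hρ
  have hρ23 : ρ ^ 23 = 1 := by
    ext ⟨x, hx⟩
    have h1 : (((ρ ^ 23) ⟨x, hx⟩ : {x // x ∈ F}) : ι) = (τ ^ 23) x := by
      rw [hρ, Equiv.Perm.subtypePerm_pow]; rfl
    rw [h1, hτ]; rfl
  have h := card_fixed_mod ρ (by norm_num : Nat.Prime 23) hρ23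
  rw [Fintype.card_coe] at h
  rw [← h]
  congr 1
  -- the two filters count the same points
  refine Finset.card_bij' (fun x hx => ⟨x, (Finset.mem_filter.mp hx).1⟩) (fun x _ => x.1) ?_ ?_ ?_ ?_
  · intro x hx
    rw [Finset.mem_filter] at hx ⊢
    refine ⟨Finset.mem_univ _, ?_⟩
    rw [hρ]; exact Subtype.ext (by rw [Equiv.Perm.subtypePerm_apply]; exact hx.2)
  · intro x hx
    rw [Finset.mem_filter] at hx ⊢
    refine ⟨x.2, ?_⟩
    have := congrArg Subtype.val hx.2
    rw [hρ, Equiv.Perm.subtypePerm_apply] at this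
    exact this
  · intro x hx; rfl
  · intro x hx; rfl

/-- the census for order 23: `1` or `24` fixed rows, and as many fixed columns -/
lemma census23 {H : Matrix ι ι ℤ} (hH : IsHadamardMatrix H) (hι : Fintype.card ι = 668)
    {π κ : Equiv.Perm ι} {d e : ι → ℤ} (haut : IsSignedAut H π κ d e) (hπ : π ^ 23 = 1) (hκ : κ ^ 23 = 1)
    (hne : π ≠ 1) :
    (univ.filter fun j => κ j = j).card = (univ.filter fun i => π i = i).card ∧
    ((univ.filter fun i => π i = i).card = 1 ∨ (univ.filter fun i => π i = i).card = 24) := by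
  have h := hadamard668_signedAut_fixedRows hH hι 23 (by norm_num) (by norm_num) π κ d e haut hπ hκ (Or.inl hne)
  refine ⟨h.1.symm, ?_⟩
  rcases h.2 with ⟨h13, -⟩ | ⟨-, h23⟩ | ⟨h37, -⟩ | ⟨h41, -⟩ | ⟨h83, -⟩ | ⟨h167, -⟩
  · norm_num at h13
  · exact h23
  · norm_num at h37
  · norm_num at h41
  · norm_num at h83
  · norm_num at h167


end Summit.Ventures.DiscreteObjects.Hadamard
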